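import Literature.Computability.AlgebraicComplexity.BI17KronRectPiece30ChunksA
import Literature.Computability.AlgebraicComplexity.BI17KronRectPiece30ChunksB
import Literature.Computability.AlgebraicComplexity.BI17KronRectPiece30ChunksC
import Literature.Computability.AlgebraicComplexity.BI17KronRectPiece30ChunksD
import Literature.Computability.AlgebraicComplexity.BI17KronRectPiece30ChunksE
import Literature.Computability.AlgebraicComplexity.BI17KronRectMixedSplitting
import Literature.Computability.AlgebraicComplexity.BI17KronRectTwoColumnSplits
import Literature.Computability.AlgebraicComplexity.BI17Ex55Proofs
import HarnessLib

/-!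
# Bürgisser–Ikenmeyer 2017, Ex. 5.6: `k_10(5) > 0` and `k_10(6) > 0` ("`5, 6 ∈ E'(10)`") — the `S_30`
# piece `g((6^5),(5^6),(10,10,10)) = 5` assembled, and `BI2017_ex_5_6` from its ten coprime atoms

P. Bürgisser, C. Ikenmeyer, *Fundamental invariants of orbit closures*, J. Algebra **477** (2017) 390–434 =
arXiv:1511.02927 [BurgisserIkenmeyer2017], Ex. 5.6 (held text `paper:arxiv-1511.02927` p0018:L125):
"`E'(10) = E'(11) = E'(12) = {0,4,5,6,7,…}`" — so `5 ∈ E'(10)` and `6 ∈ E'(10)`, i.e. `k_10(5) > 0` and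
`k_10(6) > 0` (`E'(m) = {δ | k_m(δ) > 0}` for `m > 2`, eq. (5.2); `k_m(δ) = g(m×δ, m×δ, m×δ)`; in print
computations with the DERKSEN program). THEOREMS ONLY (no definition, no named fact); a PARTIAL proof of the
shape clause of the named fact `BI2017_ex_5_6` of `BI17FundamentalInvariantTensors.lean` (val-lit row BI2017-B),
programme #8-lite of the cell (lead-bip RULINGS #54–#56; arbiter table p4 g6 07:12Z: these two atoms = t10).

## Method (ours; the two printed memberships are certified, not recomputed)

By the Kronecker semigroup property after one transposition (mixed-format splitting; in the tree three times
over: `kronRect_pos_of_pieces` / `kronRect_ten_five_pos_of_kronSum` / `kronRect_ten_six_pos_of_kronSum` of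
`BI17KronRectMixedSplitting.lean` (val-lit t08), `kronRect_pos_of_split₂` of `BI17KronRectTwoColumnSplits.lean`
(val-lit t04)): `((10^5),(10^5),(5^10)) = ((4^5),(4^5),(2^10)) + ((6^5),(6^5),(3^10))` and
`((10^6),(10^6),(6^10)) = 2 · ((5^6),(5^6),(3^10))` row-wise (`(x^y)` = `y` rows of length `x`); the two-column
piece `g((4^5),(4^5),(2^10)) = 1` is Ikenmeyer–Panova's Cor. 6.10 / a kernel value (`Mixed.kronSum_twenty_pos`),
and BOTH remaining pieces are, after a transposition, the ONE three-row Kronecker coefficient of `S_30`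
`g((6^5),(5^6),(10,10,10))`, here CERTIFIED `= 5`:

1. `Piece30.kronSum_piece`: `kronSum 30 (6^5) (5^6) (10^3) = 5 · 30!`, re-added (x4's
   `Ex55.kronSum_eq_of_chunkValues`, no class sum unfolded here) from the identity term and the `29` landed chunk
   certificates of `BI17KronRectPiece30ChunksA–E.lean` (the tree's verified Murnaghan–Nakayama evaluator
   `MNEval.kronSum`; chunks `p ≤ 7` themselves re-added from sub-chunks by the second largest cycle length);
2. `Piece30.kroneckerCoeff_piece_eq_five`: hence `g((6^5),(5^6),(10,10,10)) = 5` (`MNEval.kroneckerCoeff_eq_kronSum_div`);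
3. the transposition property (`kroneckerCoeff_transpose`, `kroneckerCoeff_transpose₁₃`, Ikenmeyer–Panova 2017
   §1.1) turns this into `g((6^5),(6^5),(3^10)) = 5` and `g((5^6),(5^6),(3^10)) = 5`, i.e. the class-sum
   hypotheses `Piece30.kronSum_pos_six_five` / `Piece30.kronSum_pos_five_six` of t08's two reductions;
4. **`kronRect_ten_five_pos : 0 < kronRect ℂ 10 5`**, **`kronRect_ten_six_pos : 0 < kronRect ℂ 10 6`**, and the
   degrees `50, 60 ∈ E(10)` (`fifty_mem_genericTensorDegreeMonoid_ten`, `sixty_mem_genericTensorDegreeMonoid_ten`);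
5. **`BI2017_ex_5_6_of_coprime_atoms`**: with t04's `kronRect_eight_four_pos`, `kronRect_twelve_six_pos` and t08's
   `BI2017_ex_5_6_of_atoms`, the named fact `BI2017_ex_5_6` follows from its TEN remaining COPRIME atoms
   `k_7(5), k_7(6), k_8(5), k_9(5), k_10(7), k_11(5), k_11(6), k_11(7), k_12(5), k_12(7) > 0` (Kronecker
   coefficients in `S_35, …, S_84`, inert for every semigroup splitting since `gcd(m, δ) = 1`; Amanov–Yeliussizov,
   arXiv:2202.11059 §9 Table 4, print `k_7(5) = 1456`, `k_8(5) = 9854`, `k_7(6) = 438744` — locators only, no facts).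

`BI2017_ex_5_6` itself stays OPEN. Honest framing: typed-literature bookkeeping for the cell `val-lit` (LADDER-
VALIANT V3, a known-results layer); nothing here bears on VP versus VNP, which is NOT proved.

## References

* [BurgisserIkenmeyer2017] P. Bürgisser, C. Ikenmeyer, J. Algebra 477 (2017) 390–434 = arXiv:1511.02927, §5
  eq. (5.2), Ex. 5.6, Rem. 5.18.
* [IkenmeyerPanova2017] C. Ikenmeyer, G. Panova, Adv. Math. 319 (2017) 40–66 = arXiv:1512.03798, §1.1
  (semigroup and transposition properties), Cor. 6.10.
* [FultonHarrisGTM129] W. Fulton, J. Harris, *Representation Theory*, Exercise 4.51 (the character formula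
  behind `MNEval.kronSum`).

## Mathlib and tree

Tree: `Piece30.ident30`, `Piece30.chunk30_2`, …, `Piece30.chunk30_30` (`BI17KronRectPiece30ChunksA–E`);
`Ex55.kronSum_eq_of_chunkValues` (`BI17Ex55Proofs`); `MNEval.kroneckerCoeff_eq_kronSum_div`,
`MNEval.kroneckerCoeff_pos_iff_kronSum_pos`; `kroneckerCoeff_transpose`, `kroneckerCoeff_transpose₁₃`,
`getD_sortedParts_transpose` (`Literature.NumberTheory.DiophantineGeometry`); `getD_sortedParts_rectangle`,
`colLen_eq_of_forall`, `parts_eq_of_getD_sortedParts_eq`, `sortedParts_congr_parts`, `transpose_rectangle_parts`,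
`kroneckerCoeff_congr_parts` (`Literature.Computability.Complexity`); `Nat.Partition.sortedParts_rectangle`;
`kronRect_ten_five_pos_of_kronSum`, `kronRect_ten_six_pos_of_kronSum`, `BI2017_ex_5_6_of_atoms`,
`BI2017_ex_5_6_shape_ten_of` (t08); `kronRect_eight_four_pos`, `kronRect_twelve_six_pos` (t04);
`genericTensorDegreeMonoid_eq_kronRect`, `kronRect`. Mathlib: `Nat.Partition.ofSums`, `Multiset.replicate`.
-/

open _root_.Literature.NumberTheory.DiophantineGeometry
open _root_.Literature.Computability.Complexity
open _root_.Literature.RepresentationTheory.FiniteGroups.MNEval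

namespace Literature.Computability.AlgebraicComplexity

namespace Piece30

/-! ### 1. The class sum `30! · g((6^5),(5^6),(10^3)) = 5 · 30!` from the landed chunks -/

/-- **`30! · g((6,6,6,6,6),(5,5,5,5,5,5),(10,10,10)) = 5 · 30!`**, re-added from the identity term and the
`29` chunk certificates `p = 2, …, 30` through `Ex55.kronSum_eq_of_chunkValues` (so that the kernel never
unfolds a class sum here). [cite: BurgisserIkenmeyer2017, Ex. 5.6] -/
theorem kronSum_piece :
    kronSum 30 [6, 6, 6, 6, 6] [5, 5, 5, 5, 5, 5] [10, 10, 10] = (5 : ℤ) * ((30).factorial : ℕ) := by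
  have hr : List.range' 2 (30 - 1) =
      [2, 3, 4, 5, 6, 7, 8, 9, 10, 11, 12, 13, 14, 15, 16, 17, 18, 19, 20, 21, 22, 23, 24, 25,
        26, 27, 28, 29, 30] := by decide
  have hv : List.Forall₂
      (fun p v => (((cycleTypesAux (30 - 1) (30 - p) p).map
        fun l => kronTerm 30 [6, 6, 6, 6, 6] [5, 5, 5, 5, 5, 5] [10, 10, 10] (p :: l))).sum = v)
      (List.range' 2 (30 - 1))
      [-765769915564984510689044082947400, 1201965591746427313136249318400000, -280457536077193093312530380544000, 7812510056642600464993379942400, -102784508556192979257950208000000, -14811455040533344260587520000000, 0, 104791253259137208350146560000000,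
        -26525285981219105863630848000000, 0, 0, 0, 0, 0, 0, 0,
        0, 0, 0, 0, 0, 0, 0, 0,
        0, 0, 0, 0, 0] := by
    rw [hr]
    exact
       .cons chunk30_2 <| .cons chunk30_3 <| .cons chunk30_4 <| .cons chunk30_5 <|
       .cons chunk30_6 <| .cons chunk30_7 <| .cons chunk30_8 <| .cons chunk30_9 <|
       .cons chunk30_10 <| .cons chunk30_11 <| .cons chunk30_12 <| .cons chunk30_13 <|
       .cons chunk30_14 <| .cons chunk30_15 <| .cons chunk30_16 <| .cons chunk30_17 <|
       .cons chunk30_18 <| .cons chunk30_19 <| .cons chunk30_20 <| .cons chunk30_21 <|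
       .cons chunk30_22 <| .cons chunk30_23 <| .cons chunk30_24 <| .cons chunk30_25 <|
       .cons chunk30_26 <| .cons chunk30_27 <| .cons chunk30_28 <| .cons chunk30_29 <|
       .cons chunk30_30 <| .nil
  rw [Ex55.kronSum_eq_of_chunkValues 30 [6, 6, 6, 6, 6] [5, 5, 5, 5, 5, 5] [10, 10, 10] (by norm_num) _ _
    ident30 hv]
  decide

/-! ### 2. Rows and parts of the partitions involved -/

/-- Zero-padded rows of the transpose of a partition with `m` rows of length `c`: `c` rows of length `m`.
[folklore] -/
private theorem getD_sortedParts_transpose_of_rows {N m c : ℕ} {τ : Nat.Partition N}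
    (hτ : ∀ r, τ.sortedParts.getD r 0 = if r < m then c else 0) (r : ℕ) :
    τ.transpose.sortedParts.getD r 0 = if r < c then m else 0 := by
  rw [getD_sortedParts_transpose]
  refine colLen_eq_of_forall τ fun i => ?_
  rw [hτ i]
  constructor <;> intro h <;> split_ifs at h ⊢ <;> omega

/-- The parts of `Nat.Partition.ofSums N (replicate m c)` are those of the rectangle `m × c` (both are the
non-zero entries of `replicate m c`). [folklore] -/
private theorem parts_ofSums_replicate_eq_rectangle {N m c : ℕ} (h : (Multiset.replicate m c).sum = N) :
    (Nat.Partition.ofSums N (Multiset.replicate m c) h).parts = (Nat.Partition.rectangle m c).parts := rfl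

/-- Sorted parts of `Nat.Partition.ofSums N (replicate m c)`, `c ≠ 0`: the constant list. [folklore] -/
private theorem sortedParts_ofSums_replicate {N m c : ℕ} (hc : c ≠ 0) (h : (Multiset.replicate m c).sum = N) :
    (Nat.Partition.ofSums N (Multiset.replicate m c) h).sortedParts = List.replicate m c := by
  rw [sortedParts_congr_parts (parts_ofSums_replicate_eq_rectangle h),
    Nat.Partition.sortedParts_rectangle m c hc]

/-- Zero-padded rows of `Nat.Partition.ofSums N (replicate m c)`: `m` rows of length `c`. [folklore] -/
private theorem getD_sortedParts_ofSums_replicate {N m c : ℕ} (h : (Multiset.replicate m c).sum = N) (r : ℕ) :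
    (Nat.Partition.ofSums N (Multiset.replicate m c) h).sortedParts.getD r 0 = if r < m then c else 0 := by
  rw [← getD_sortedParts_rectangle m c r]
  exact congrArg (fun l : List ℕ => l.getD r 0)
    (sortedParts_congr_parts (parts_ofSums_replicate_eq_rectangle h))

/-- Sorted parts of the transposed rectangle `(5 × 6)ᵀ = 6 × 5`. [folklore] -/
private theorem sortedParts_transpose_rectangle_five_six :
    (Nat.Partition.rectangle 5 6).transpose.sortedParts = [5, 5, 5, 5, 5, 5] := by
  rw [sortedParts_congr_parts (transpose_rectangle_parts 5 6), Nat.Partition.sortedParts_rectangle 6 5 (by norm_num)]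
  rfl

/-! ### 3. The value `g((6^5),(5^6),(10,10,10)) = 5` and its two transposed readings -/

/-- **`g((6,6,6,6,6),(5,5,5,5,5,5),(10,10,10)) = 5`**, the three-row piece as a Kronecker coefficient
(partitions of `5·6`: the rectangle `5 × 6`, its transpose, and `(10,10,10)`), from `kronSum_piece` and
`MNEval.kroneckerCoeff_eq_kronSum_div`. [cite: BurgisserIkenmeyer2017, Ex. 5.6] -/
theorem kroneckerCoeff_piece_eq_five :
    kroneckerCoeff ℂ (Nat.Partition.rectangle 5 6) (Nat.Partition.rectangle 5 6).transpose
      (Nat.Partition.ofSums (5 * 6) (Multiset.replicate 3 10) (by simp)) = 5 := by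
  have h1 := kroneckerCoeff_eq_kronSum_div (Nat.Partition.rectangle 5 6)
    (Nat.Partition.rectangle 5 6).transpose
    (Nat.Partition.ofSums (5 * 6) (Multiset.replicate 3 10) (by simp))
  have h2 : kronSum (5 * 6) [6, 6, 6, 6, 6] [5, 5, 5, 5, 5, 5] [10, 10, 10] =
      (5 : ℤ) * ((5 * 6).factorial : ℕ) := kronSum_piece
  rw [Nat.Partition.sortedParts_rectangle 5 6 (by norm_num), sortedParts_transpose_rectangle_five_six,
    sortedParts_ofSums_replicate (by norm_num), show List.replicate 5 6 = [6, 6, 6, 6, 6] from rfl,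
    show List.replicate 3 10 = [10, 10, 10] from rfl, h2,
    Int.mul_ediv_cancel _ (by exact_mod_cast Nat.factorial_ne_zero _)] at h1
  exact_mod_cast h1

/-- **First transposed reading: `g((6^5),(6^5),(3^10)) = 5`** (`g(λ, μ, ν) = g(λ, μᵀ, νᵀ)`,
Ikenmeyer–Panova 2017 §1.1). [cite: IkenmeyerPanova2017, §1.1 (the transposition property)] -/
theorem kroneckerCoeff_rect_five_six_eq_five :
    kroneckerCoeff ℂ (Nat.Partition.rectangle 5 6) (Nat.Partition.rectangle 5 6)
      (Nat.Partition.ofSums (5 * 6) (Multiset.replicate 10 3) (by simp)) = 5 := by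
  have hT : (Nat.Partition.ofSums (5 * 6) (Multiset.replicate 10 3) (by simp)).transpose =
      Nat.Partition.ofSums (5 * 6) (Multiset.replicate 3 10) (by simp) := by
    refine Nat.Partition.ext (Complexity.parts_eq_of_getD_sortedParts_eq fun r => ?_)
    rw [getD_sortedParts_transpose_of_rows
      (getD_sortedParts_ofSums_replicate (N := 5 * 6) (m := 10) (c := 3) (by simp)) r,
      getD_sortedParts_ofSums_replicate (N := 5 * 6) (m := 3) (c := 10) (by simp) r]
  rw [kroneckerCoeff_transpose ℂ, hT]
  exact kroneckerCoeff_piece_eq_five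

/-- **Second transposed reading: `g((5^6),(5^6),(3^10)) = 5`** (partitions of `6·5`; `g(λ, μ, ν) =
g(λᵀ, μ, νᵀ)` and transport along `6·5 = 5·6`). [cite: IkenmeyerPanova2017, §1.1 (the transposition property)] -/
theorem kroneckerCoeff_rect_six_five_eq_five :
    kroneckerCoeff ℂ (Nat.Partition.rectangle 6 5) (Nat.Partition.rectangle 6 5)
      (Nat.Partition.ofSums (6 * 5) (Multiset.replicate 10 3) (by simp)) = 5 := by
  rw [kroneckerCoeff_transpose₁₃ ℂ]
  refine (kroneckerCoeff_congr_parts (by norm_num) (transpose_rectangle_parts 6 5)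
    (transpose_rectangle_parts 5 6).symm (Complexity.parts_eq_of_getD_sortedParts_eq fun r => ?_)).trans
    kroneckerCoeff_piece_eq_five
  rw [getD_sortedParts_transpose_of_rows
      (getD_sortedParts_ofSums_replicate (N := 6 * 5) (m := 10) (c := 3) (by simp)) r,
    getD_sortedParts_ofSums_replicate (N := 5 * 6) (m := 3) (c := 10) (by simp) r]

/-- The class-sum hypothesis of `kronRect_ten_five_pos_of_kronSum`: `30! · g((6^5),(6^5),(3^10)) > 0`.
[cite: BurgisserIkenmeyer2017, Ex. 5.6] -/
theorem kronSum_pos_six_five :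
    0 < kronSum (5 * 6) (List.replicate 5 6) (List.replicate 5 6) (List.replicate 10 3) := by
  have h := (kroneckerCoeff_pos_iff_kronSum_pos (Nat.Partition.rectangle 5 6) (Nat.Partition.rectangle 5 6)
    (Nat.Partition.ofSums (5 * 6) (Multiset.replicate 10 3) (by simp))).1
    (by rw [kroneckerCoeff_rect_five_six_eq_five]; norm_num)
  rwa [Nat.Partition.sortedParts_rectangle 5 6 (by norm_num), sortedParts_ofSums_replicate (by norm_num)] at h

/-- The class-sum hypothesis of `kronRect_ten_six_pos_of_kronSum`: `30! · g((5^6),(5^6),(3^10)) > 0`.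
[cite: BurgisserIkenmeyer2017, Ex. 5.6] -/
theorem kronSum_pos_five_six :
    0 < kronSum (6 * 5) (List.replicate 6 5) (List.replicate 6 5) (List.replicate 10 3) := by
  have h := (kroneckerCoeff_pos_iff_kronSum_pos (Nat.Partition.rectangle 6 5) (Nat.Partition.rectangle 6 5)
    (Nat.Partition.ofSums (6 * 5) (Multiset.replicate 10 3) (by simp))).1
    (by rw [kroneckerCoeff_rect_six_five_eq_five]; norm_num)
  rwa [Nat.Partition.sortedParts_rectangle 6 5 (by norm_num), sortedParts_ofSums_replicate (by norm_num)] at h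

end Piece30

open Piece30

/-! ### 4. The two atoms and the degrees `50, 60 ∈ E(10)` -/

/-- **`k_10(5) > 0`, i.e. `5 ∈ E'(10) = {0,4,5,6,7,…}`** (BI 2017 Ex. 5.6; in print a DERKSEN computation):
mixed-format splitting `((10^5),(10^5),(5^10)) = ((4^5),(4^5),(2^10)) + ((6^5),(6^5),(3^10))`
(`kronRect_ten_five_pos_of_kronSum`, val-lit t08) with the certified `S_30` piece `Piece30.kronSum_pos_six_five`.
[cite: BurgisserIkenmeyer2017, Ex. 5.6] -/
theorem kronRect_ten_five_pos : 0 < kronRect ℂ 10 5 :=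
  kronRect_ten_five_pos_of_kronSum kronSum_pos_six_five

/-- **`k_10(6) > 0`, i.e. `6 ∈ E'(10) = {0,4,5,6,7,…}`** (BI 2017 Ex. 5.6; in print a DERKSEN computation):
mixed-format splitting `((10^6),(10^6),(6^10)) = 2 · ((5^6),(5^6),(3^10))` (`kronRect_ten_six_pos_of_kronSum`,
val-lit t08) with the certified `S_30` piece `Piece30.kronSum_pos_five_six`. [cite: BurgisserIkenmeyer2017, Ex. 5.6] -/
theorem kronRect_ten_six_pos : 0 < kronRect ℂ 10 6 :=
  kronRect_ten_six_pos_of_kronSum kronSum_pos_five_six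

/-- **BI 2017 Ex. 5.6: `50 ∈ E(10)`** (`⊗³ℂ^{10}` has a non-zero `SL_{10}³`-invariant of degree `50`), from
`k_10(5) > 0` and `E(m) = {mδ : k_m(δ) > 0}`. [cite: BurgisserIkenmeyer2017, Ex. 5.6] -/
theorem fifty_mem_genericTensorDegreeMonoid_ten : 50 ∈ genericTensorDegreeMonoid (Fin 10) ℂ := by
  rw [genericTensorDegreeMonoid_eq_kronRect]
  exact ⟨5, by norm_num, kronRect_ten_five_pos⟩

/-- **BI 2017 Ex. 5.6: `60 ∈ E(10)`** (`⊗³ℂ^{10}` has a non-zero `SL_{10}³`-invariant of degree `60`), from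
`k_10(6) > 0`. [cite: BurgisserIkenmeyer2017, Ex. 5.6] -/
theorem sixty_mem_genericTensorDegreeMonoid_ten : 60 ∈ genericTensorDegreeMonoid (Fin 10) ℂ := by
  rw [genericTensorDegreeMonoid_eq_kronRect]
  exact ⟨6, by norm_num, kronRect_ten_six_pos⟩

/-! ### 5. `BI2017_ex_5_6` from its ten coprime atoms -/

/-- **The shape of `E(10)` from ONE remaining atom**: `k_10(7) > 0` alone now gives
`E(10) = {0} ∪ (e(10) + 10ℕ)` (t08's `BI2017_ex_5_6_shape_ten_of` with `k_10(5), k_10(6) > 0` supplied).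
[cite: BurgisserIkenmeyer2017, Ex. 5.6] -/
theorem BI2017_ex_5_6_shape_ten_of' (h7 : 0 < kronRect ℂ 10 7) :
    genericTensorDegreeMonoid (Fin 10) ℂ =
      {d | d = 0 ∨ ∃ δ : ℕ, d = 10 * δ ∧ genericTensorMinimalDegree (Fin 10) ℂ ≤ 10 * δ} :=
  BI2017_ex_5_6_shape_ten_of kronRect_ten_five_pos kronRect_ten_six_pos h7

/-- **`BI2017_ex_5_6` ⇐ its ten COPRIME atoms** `k_7(5), k_7(6), k_8(5), k_9(5), k_10(7), k_11(5), k_11(6),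
k_11(7), k_12(5), k_12(7) > 0` (Kronecker coefficients of three equal rectangles in `S_35, …, S_84`, inert for
every semigroup splitting since `gcd(m, δ) = 1`; Amanov–Yeliussizov, arXiv:2202.11059 §9 Table 4, print
`k_7(5) = 1456`, `k_8(5) = 9854`, `k_7(6) = 438744` — locators, not facts): t08's fourteen-atom reduction
`BI2017_ex_5_6_of_atoms` with the four splittable atoms supplied by `kronRect_eight_four_pos`,
`kronRect_twelve_six_pos` (val-lit t04) and `kronRect_ten_five_pos`, `kronRect_ten_six_pos` (this file). The
named fact itself stays OPEN. [cite: BurgisserIkenmeyer2017, Ex. 5.6 and Rem. 5.18] -/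
theorem BI2017_ex_5_6_of_coprime_atoms
    (h7_5 : 0 < kronRect ℂ 7 5) (h7_6 : 0 < kronRect ℂ 7 6) (h8_5 : 0 < kronRect ℂ 8 5)
    (h9_5 : 0 < kronRect ℂ 9 5) (h10_7 : 0 < kronRect ℂ 10 7) (h11_5 : 0 < kronRect ℂ 11 5)
    (h11_6 : 0 < kronRect ℂ 11 6) (h11_7 : 0 < kronRect ℂ 11 7) (h12_5 : 0 < kronRect ℂ 12 5)
    (h12_7 : 0 < kronRect ℂ 12 7) : BI2017_ex_5_6 :=
  BI2017_ex_5_6_of_atoms h7_5 h7_6 kronRect_eight_four_pos h8_5 h9_5 kronRect_ten_five_pos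
    kronRect_ten_six_pos h10_7 h11_5 h11_6 h11_7 h12_5 kronRect_twelve_six_pos h12_7

end Literature.Computability.AlgebraicComplexity
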